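import Summits.NavierStokesRegularity.NavierStokesRegularity.Theorems.ScenarioCensusLargeOrderRigidityGeom

/-!
# Scenario census, rows F13m / F13mL / F13dL — profile rigidity at diverging symmetry order:
# part 5/6: (V) far orbits ⇒ vanishing weak limit, PROVED (`farOrbitVanishing_holds`)

Port of the ideator's tree-ready kit (ns-idea-9 g6, LINE 14 «dihedral_noswirl» REV 7 025308a3fa185027; kit file 1
`pub/ideators/ns-idea-9/lines/dihedral_noswirl/landing/ScenarioCensusLargeOrderRigidity.lean`, sha16 9e20ac97d4307bb6, 1417 l., its
declarations identical in REV 6/7; ref g7 PRE-CHECK ✓ §12.34, critic idea-crit-8 V56/V57/V58 PASS) by typer seat ns-census-typer-2 g8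
(lead g8 GO 2026-08-28T18:02Z; census FROZEN v1.62 — sub-row F13dL flips to TREE on port ACCEPT + ref CHECK), split for the
400-line rule into SIX modules `ScenarioCensusLargeOrderRigidity{Vocab, Statements, P, Geom, V}` → `ScenarioCensusLargeOrderRigidity`
(this last name is the kit's, so that kit file 2 `ScenarioCensusRowF13dLargeL3.lean` — ported by typer-1 g5 — imports it unchanged).
Declarations VERBATIM in the kit's namespace `…Theorems.ScenarioCensus.LargeOrderRigidity`; the only edits: the kit's
`local notation "ℝ³"` is replaced by the abbreviation `R3` (typer lint: no notation in ported files) and one-line docstrings are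
added to undocumented auxiliaries.

No census ROW value and no summit statement is proved in this file; `Row_F13mLarge` stays OPEN.
-/

noncomputable section

set_option linter.dupNamespace false
set_option linter.unusedVariables false

open Set Function Filter Topology MeasureTheory Metric TopologicalSpace
open scoped NNReal ENNReal RealInnerProductSpace

namespace Summit.NavierStokesRegularity.NavierStokesRegularity.Theorems.ScenarioCensus.LargeOrderRigidity

open Literature.Analysis Literature.Analysis.FluidPDE
open Summit.NavierStokesRegularity.NavierStokesRegularity.Theorems.ScenarioCensus

/-! ### (V) far orbits ⇒ vanishing weak limit — PROVED (rev 3)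
The `m` rotated/translated copies `ψ_k(x) = R_k φ(R_k⁻¹(x − p_k))`, `p_k = c − R_k c`, `R_k = rotZ (2πk/m)`, of a
test field pair identically with a `C_m`-equivariant field (`integral_inner_copyOf`); for HORIZONTAL `c` the
centres are `2‖c‖|sin(π(k−l)/m)| ≥ 2‖c‖ sin(π/m)` apart (`dist_orbitPt`), so once `‖c‖ sin(π/m) > R` the copies
have disjoint supports, `‖Σ_k ψ_k‖_∞ ≤ ‖φ‖_∞` and `|supp Σ_k ψ_k| ≤ m |B_R|`, whence by Hölder with the budget
`m |⟨a, φ⟩| = |⟨a, Σ_k ψ_k⟩| ≤ M ‖φ‖_∞ (m |B_R|)^{2/3}`, i.e. `|⟨a_j, φ⟩| ≤ M ‖φ‖_∞ |B_R|^{2/3} m_j^{-1/3} → 0`.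
Standard axioms only. -/
section StubV
open Literature.Analysis.FunctionSpaces

/-- `sin(π/m) ≤ |sin(nπ/m)|` for `1 ≤ n ≤ m − 1`. -/
theorem sin_pi_div_le_abs_sin_nat_mul {m n : ℕ} (h1 : 1 ≤ n) (h2 : n + 1 ≤ m) :
    Real.sin (Real.pi / m) ≤ |Real.sin ((n : ℝ) * Real.pi / m)| := by
  have hπ := Real.pi_pos
  have hm : (0:ℝ) < m := by exact_mod_cast (show 0 < m by omega)
  have hn1 : (1:ℝ) ≤ n := by exact_mod_cast h1
  have hnm : (n:ℝ) + 1 ≤ m := by exact_mod_cast h2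
  have hx0 : 0 ≤ (n:ℝ) * Real.pi / m := by positivity
  have hxπ : (n:ℝ) * Real.pi / m ≤ Real.pi := by
    rw [div_le_iff₀ hm]; nlinarith
  rw [abs_of_nonneg (Real.sin_nonneg_of_nonneg_of_le_pi hx0 hxπ)]
  have hpm : 0 < Real.pi / m := div_pos hπ hm
  have hlow : Real.pi / m ≤ (n:ℝ) * Real.pi / m := by
    rw [div_le_div_iff_of_pos_right hm]; nlinarith
  by_cases hcase : (n:ℝ) * Real.pi / m ≤ Real.pi / 2
  · exact Real.sin_le_sin_of_le_of_le_pi_div_two (by linarith) hcase hlow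
  · rw [← Real.sin_pi_sub ((n : ℝ) * Real.pi / m)]
    push Not at hcase
    refine Real.sin_le_sin_of_le_of_le_pi_div_two (by linarith) (by linarith) ?_
    rw [le_sub_iff_add_le, ← add_div, div_le_iff₀ hm]
    nlinarith

/-- the centre of the `k`-th copy: `p_k = c − R_k c`. -/
def orbitPt (m : ℕ) (c : R3) (k : ℕ) : R3 := c - rotZ ((k : ℝ) * (2 * Real.pi / m)) c

/-- the rotation `R_k = rotZ (2πk/m)` as a linear isometry equivalence. -/
def orbitRot (m k : ℕ) : R3 ≃ₗᵢ[ℝ] R3 := rotZLIE ((k : ℝ) * (2 * Real.pi / m))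

/-- the `k`-th copy `ψ_k(x) = R_k φ(R_k⁻¹ (x − p_k))` of a test field. -/
def copyOf (φ : R3 → R3) (m : ℕ) (c : R3) (k : ℕ) : R3 → R3 :=
  fun x => orbitRot m k (φ ((orbitRot m k).symm (x - orbitPt m c k)))

/-- the sum of the `m` copies. -/
def copySum (φ : R3 → R3) (m : ℕ) (c : R3) : R3 → R3 :=
  fun x => ∑ k ∈ Finset.range m, copyOf φ m c k x

/-- Auxiliary step of LINE 14 «dihedral_noswirl» (`norm_orbitPt_sub`), ported verbatim. -/
theorem norm_orbitPt_sub {c : R3} (hc : c 2 = 0) (m k l : ℕ) :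
    ‖orbitPt m c k - orbitPt m c l‖
      = 2 * ‖c‖ * |Real.sin (((k : ℝ) - l) * (2 * Real.pi / m) / 2)| := by
  have e : orbitPt m c k - orbitPt m c l
      = rotZ ((l : ℝ) * (2 * Real.pi / m)) (c - rotZ (((k : ℝ) - l) * (2 * Real.pi / m)) c) := by
    unfold orbitPt
    rw [rotZ_map_sub, ← rotZ_add,
      show (l : ℝ) * (2 * Real.pi / m) + ((k : ℝ) - l) * (2 * Real.pi / m) = (k : ℝ) * (2 * Real.pi / m) by ring]
    abel
  rw [e, norm_rotZ, norm_sub_rotZ_eq hc]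

/-- **separation of the copies** for horizontal `c`: distinct centres are `≥ 2‖c‖ sin(π/m)` apart. -/
theorem dist_orbitPt {c : R3} (hc : c 2 = 0) {m k l : ℕ} (hk : k < m) (hl : l < m) (hkl : k ≠ l) :
    2 * (‖c‖ * Real.sin (Real.pi / m)) ≤ ‖orbitPt m c k - orbitPt m c l‖ := by
  rw [norm_orbitPt_sub hc,
    show ((k : ℝ) - l) * (2 * Real.pi / m) / 2 = ((k : ℝ) - l) * Real.pi / m by ring]
  have key : Real.sin (Real.pi / m) ≤ |Real.sin (((k : ℝ) - l) * Real.pi / m)| := by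
    rcases lt_or_gt_of_ne hkl with h | h
    · have e1 : ((k : ℝ) - l) * Real.pi / m = -((((l - k : ℕ) : ℝ)) * Real.pi / m) := by
        rw [Nat.cast_sub h.le]; ring
      rw [e1, Real.sin_neg, abs_neg]
      exact sin_pi_div_le_abs_sin_nat_mul (by omega) (by omega)
    · have e1 : ((k : ℝ) - l) * Real.pi / m = (((k - l : ℕ) : ℝ)) * Real.pi / m := by
        rw [Nat.cast_sub h.le]
      rw [e1]
      exact sin_pi_div_le_abs_sin_nat_mul (by omega) (by omega)
  have := mul_le_mul_of_nonneg_left key (by positivity : (0:ℝ) ≤ 2 * ‖c‖)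
  linarith

/-- Auxiliary step of LINE 14 «dihedral_noswirl» (`copyOf_test`), ported verbatim. -/
theorem copyOf_test {φ : R3 → R3} (hφ : IsTestFunctionOn (⊤ : Opens R3) φ) (m : ℕ) (c : R3) (k : ℕ) :
    IsTestFunctionOn (⊤ : Opens R3) (copyOf φ m c k) :=
  isTestFunctionOn_isometry_comp (isTestFunctionOn_comp_affine hφ (orbitRot m k) (orbitPt m c k))
    (orbitRot m k)

/-- Auxiliary step of LINE 14 «dihedral_noswirl» (`norm_copyOf`), ported verbatim. -/
theorem norm_copyOf (φ : R3 → R3) (m : ℕ) (c : R3) (k : ℕ) (x : R3) :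
    ‖copyOf φ m c k x‖ = ‖φ ((orbitRot m k).symm (x - orbitPt m c k))‖ := by
  unfold copyOf
  rw [LinearIsometryEquiv.norm_map]

/-- Auxiliary step of LINE 14 «dihedral_noswirl» (`copyOf_eq_zero`), ported verbatim. -/
theorem copyOf_eq_zero {φ : R3 → R3} {R : ℝ} (hR : ∀ x, R < ‖x‖ → φ x = 0) {m : ℕ} {c : R3} {k : ℕ}
    {x : R3} (hx : R < ‖x - orbitPt m c k‖) : copyOf φ m c k x = 0 := by
  unfold copyOf
  rw [hR _ (by rwa [LinearIsometryEquiv.norm_map]), map_zero]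

/-- **each copy pairs like `φ`** with a `C_m`-equivariant field (change of variables + equivariance). -/
theorem integral_inner_copyOf {m : ℕ} {c : R3} {u : R3 → R3} (hsym : IsCyclicEquivariantAbout m c u)
    (φ : R3 → R3) (k : ℕ) : ∫ x, ⟪u x, copyOf φ m c k x⟫ = ∫ x, ⟪u x, φ x⟫ := by
  have hequi : ∀ y, u (orbitPt m c k + orbitRot m k y) = orbitRot m k (u y) := fun y =>
    affine_of_equivariant (hsym.iterate k) y
  have h := integral_inner_comp_affine u (fun y => orbitRot m k (φ y)) (orbitRot m k) (orbitPt m c k)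
  beta_reduce at h
  unfold copyOf
  rw [← h]
  refine integral_congr_ae (Eventually.of_forall fun y => ?_)
  beta_reduce
  rw [hequi y, LinearIsometryEquiv.inner_map_map]

/-- under separation, at each point at most one copy is non-zero: `‖Σ_k ψ_k(x)‖ ≤ ‖φ‖_∞`. -/
theorem norm_copySum_le {φ : R3 → R3} {C R : ℝ} (hC0 : 0 ≤ C) (hC : ∀ x, ‖φ x‖ ≤ C)
    (hR : ∀ x, R < ‖x‖ → φ x = 0) {m : ℕ} {c : R3} (hc : c 2 = 0)
    (hsep : R < ‖c‖ * Real.sin (Real.pi / m)) (x : R3) : ‖copySum φ m c x‖ ≤ C := by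
  unfold copySum
  by_cases h : ∃ k ∈ Finset.range m, copyOf φ m c k x ≠ 0
  · obtain ⟨k, hk, hne⟩ := h
    rw [Finset.sum_eq_single_of_mem k hk (fun l hl hlk => ?_)]
    · rw [norm_copyOf]; exact hC _
    · by_contra hne'
      have h1 : ‖x - orbitPt m c k‖ ≤ R := not_lt.1 fun h => hne (copyOf_eq_zero hR h)
      have h2 : ‖x - orbitPt m c l‖ ≤ R := not_lt.1 fun h => hne' (copyOf_eq_zero hR h)
      have h3 := dist_orbitPt hc (Finset.mem_range.1 hk) (Finset.mem_range.1 hl) (Ne.symm hlk)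
      have h4 : ‖orbitPt m c k - orbitPt m c l‖ ≤ ‖x - orbitPt m c l‖ + ‖x - orbitPt m c k‖ := by
        have := norm_sub_le (x - orbitPt m c l) (x - orbitPt m c k)
        rwa [sub_sub_sub_cancel_left] at this
      linarith
  · push Not at h
    rw [Finset.sum_eq_zero h, norm_zero]
    exact hC0

/-- the copies live in the union of the balls `B̄(p_k, R)`. -/
theorem support_copySum_subset {φ : R3 → R3} {R : ℝ} (hR : ∀ x, R < ‖x‖ → φ x = 0) (m : ℕ) (c : R3) :
    support (copySum φ m c) ⊆ ⋃ k ∈ Finset.range m, closedBall (orbitPt m c k) R := by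
  intro x hx
  rw [mem_support] at hx
  unfold copySum at hx
  obtain ⟨k, hk, hne⟩ := Finset.exists_ne_zero_of_sum_ne_zero hx
  refine mem_biUnion hk ?_
  rw [mem_closedBall, dist_eq_norm]
  exact not_lt.1 fun h => hne (copyOf_eq_zero hR h)

/-- **the sum of the copies pairs like `m` copies of `φ`.** -/
theorem integral_inner_copySum {m : ℕ} {c : R3} {u : R3 → R3} (hu : MemLp u 3 volume)
    (hsym : IsCyclicEquivariantAbout m c u) {φ : R3 → R3} (hφ : IsTestFunctionOn (⊤ : Opens R3) φ) :
    ∫ x, ⟪u x, copySum φ m c x⟫ = (m : ℝ) * ∫ x, ⟪u x, φ x⟫ := by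
  unfold copySum
  simp_rw [inner_sum]
  rw [integral_finsetSum _ (fun k _ => integrable_inner_test hu (copyOf_test hφ m c k))]
  simp_rw [integral_inner_copyOf hsym]
  rw [Finset.sum_const, Finset.card_range, nsmul_eq_mul]

/-- **`L^{3/2}` size of the sum of the copies** under separation: `≤ (m |B_R|)^{2/3} ‖φ‖_∞`. -/
theorem eLpNorm_copySum_le {φ : R3 → R3} {C R : ℝ} (hC0 : 0 ≤ C) (hC : ∀ x, ‖φ x‖ ≤ C)
    (hR : ∀ x, R < ‖x‖ → φ x = 0) {m : ℕ} {c : R3} (hc : c 2 = 0)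
    (hsep : R < ‖c‖ * Real.sin (Real.pi / m)) :
    eLpNorm (copySum φ m c) (3 / 2 : ℝ≥0∞) volume
      ≤ ((m : ℝ≥0∞) * volume (closedBall (0 : R3) R)) ^ (2 / 3 : ℝ) * ENNReal.ofReal C := by
  have hpr : (3 / 2 : ℝ≥0∞).toReal⁻¹ = 2 / 3 := by
    rw [ENNReal.toReal_div]; norm_num
  set S : Set R3 := ⋃ k ∈ Finset.range m, closedBall (orbitPt m c k) R with hS
  have hsupp := support_copySum_subset hR m c (φ := φ)
  rw [← eLpNorm_restrict_eq_of_support_subset hsupp]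
  refine (eLpNorm_le_of_ae_bound (C := C)
    (Eventually.of_forall fun x => norm_copySum_le hC0 hC hR hc hsep x)).trans ?_
  rw [Measure.restrict_apply_univ, hpr]
  gcongr
  calc volume S ≤ ∑ k ∈ Finset.range m, volume (closedBall (orbitPt m c k) R) :=
        measure_biUnion_finset_le _ _
    _ = ∑ k ∈ Finset.range m, volume (closedBall (0 : R3) R) := by
        refine Finset.sum_congr rfl fun k _ => ?_
        exact Measure.addHaar_closedBall_center volume _ _
    _ = (m : ℝ≥0∞) * volume (closedBall (0 : R3) R) := by
        rw [Finset.sum_const, Finset.card_range, nsmul_eq_mul]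

/-- **(V) holds** (rev 3: formerly `stub_farOrbitVanishing … sorry`). -/
theorem farOrbitVanishing_holds : FarOrbitVanishing := by
  intro M m c a f hm hc ha hsym hf hweak hfar
  refine ae_eq_zero_of_forall_integral_inner_test_eq_zero (hf.locallyIntegrable (by norm_num))
    fun φ hφ => ?_
  obtain ⟨C, R, hC0, hC, hR⟩ := testFun_bound_radius hφ
  refine tendsto_nhds_unique (hweak φ hφ) ?_
  -- constants
  have hBfin : volume (closedBall (0 : R3) R) ≠ ∞ := measure_closedBall_lt_top.ne
  set v : ℝ := (volume (closedBall (0 : R3) R)).toReal with hv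
  have hv0 : 0 ≤ v := ENNReal.toReal_nonneg
  set K : ℝ := (M : ℝ) * C * v ^ (2 / 3 : ℝ) with hK
  -- the rate `K m_j^{-1/3} → 0`
  have hlim : Tendsto (fun j => K * ((m j : ℝ) ^ (-(1 / 3 : ℝ)))) atTop (𝓝 0) := by
    have h1 := (tendsto_rpow_neg_atTop (show (0:ℝ) < 1 / 3 by norm_num)).comp
      ((tendsto_natCast_atTop_atTop (R := ℝ)).comp hm)
    simpa [Function.comp_def] using h1.const_mul K
  have hev : ∀ᶠ j in atTop, R < ‖c j‖ * Real.sin (Real.pi / m j) ∧ 1 ≤ m j :=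
    (hfar.eventually (eventually_gt_atTop R)).and (hm.eventually (eventually_ge_atTop 1))
  refine squeeze_zero_norm' (hev.mono fun j hj => ?_) hlim
  obtain ⟨hsep, hm1⟩ := hj
  have hmpos : (0 : ℝ) < m j := by exact_mod_cast hm1
  -- `m I = ⟨a_j, Σ_k ψ_k⟩`, Hölder with the budget and the size of the sum
  have hsum := integral_inner_copySum (ha j).1 (hsym j) hφ
  have hΦ : MemLp (copySum φ (m j) (c j)) (3 / 2 : ℝ≥0∞) volume := by
    unfold copySum
    exact memLp_finsetSum _ (fun k _ => testFun_memLp (copyOf_test hφ (m j) (c j) k) _)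
  have hH := abs_integral_inner_le_eLpNorm_three_mul_threeHalves (ha j).1 hΦ
  have hE := eLpNorm_copySum_le hC0 hC hR (hc j) hsep
  have hEfin : ((m j : ℝ≥0∞) * volume (closedBall (0 : R3) R)) ^ (2 / 3 : ℝ) * ENNReal.ofReal C ≠ ∞ :=
    ENNReal.mul_ne_top (ENNReal.rpow_ne_top_of_nonneg (by norm_num)
      (ENNReal.mul_ne_top (ENNReal.natCast_ne_top _) hBfin)) ENNReal.ofReal_ne_top
  have hE' : (eLpNorm (copySum φ (m j) (c j)) (3 / 2 : ℝ≥0∞) volume).toReal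
      ≤ ((m j : ℝ) * v) ^ (2 / 3 : ℝ) * C := by
    have := ENNReal.toReal_mono hEfin hE
    rw [ENNReal.toReal_mul, ← ENNReal.toReal_rpow, ENNReal.toReal_mul, ENNReal.toReal_ofReal hC0,
      ENNReal.toReal_natCast] at this
    exact this
  have hM : (eLpNorm (a j) 3 volume).toReal ≤ M := by
    exact_mod_cast ENNReal.toReal_mono ENNReal.coe_ne_top (ha j).2
  -- assemble: `m |I| ≤ M (m v)^{2/3} C`
  have h1 : (m j : ℝ) * |∫ x, ⟪a j x, φ x⟫| ≤ (M : ℝ) * (((m j : ℝ) * v) ^ (2 / 3 : ℝ) * C) := by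
    have e : |∫ x, ⟪a j x, copySum φ (m j) (c j) x⟫| = (m j : ℝ) * |∫ x, ⟪a j x, φ x⟫| := by
      rw [hsum, abs_mul, abs_of_pos hmpos]
    rw [← e]
    refine hH.trans ?_
    gcongr
  -- `(m v)^{2/3} = m · m^{-1/3} · v^{2/3}`
  have e2 : ((m j : ℝ) * v) ^ (2 / 3 : ℝ) = (m j : ℝ) * ((m j : ℝ) ^ (-(1 / 3 : ℝ))) * v ^ (2 / 3 : ℝ) := by
    rw [Real.mul_rpow hmpos.le hv0, show (2 / 3 : ℝ) = 1 + (-(1 / 3 : ℝ)) by norm_num,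
      Real.rpow_add hmpos, Real.rpow_one]
  rw [Real.norm_eq_abs]
  rw [e2] at h1
  have h2 : (m j : ℝ) * |∫ x, ⟪a j x, φ x⟫| ≤ (m j : ℝ) * (K * (m j : ℝ) ^ (-(1 / 3 : ℝ))) := by
    calc (m j : ℝ) * |∫ x, ⟪a j x, φ x⟫|
        ≤ (M : ℝ) * ((m j : ℝ) * ((m j : ℝ) ^ (-(1 / 3 : ℝ))) * v ^ (2 / 3 : ℝ) * C) := h1
      _ = (m j : ℝ) * (K * (m j : ℝ) ^ (-(1 / 3 : ℝ))) := by rw [hK]; ring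
  exact le_of_mul_le_mul_left h2 hmpos

end StubV
end Summit.NavierStokesRegularity.NavierStokesRegularity.Theorems.ScenarioCensus.LargeOrderRigidity

end
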